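import Literature.AlgebraicGeometry.Frobenioids.RigiditySlimness
import Literature.AlgebraicGeometry.Frobenioids.PadicFrobenioidThm12
import Literature.AlgebraicGeometry.Frobenioids.PadicFrobenioidDatumLemmas
import Literature.AlgebraicGeometry.Frobenioids.PadicFrobenioidUnitGroups
import Literature.AlgebraicGeometry.Frobenioids.PadicUnitsDivisible
import HarnessLib

/-!
# Frobenioids II, Theorem 1.2 (iv): a `p`-adic Frobenioid over a slim base is slim — UNCONDITIONAL

Mochizuki, *The geometry of Frobenioids II*, Kyushu J. Math. **62** (2008) 401–460, §1, Theorem 1.2 (iv),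
kurims p. 9 [cite: MochizukiFrdII2008, Thm 1.2 (iv) p.9]: "If `D` is slim, and `Λ ∈ {ℤ, ℝ}`, then `C` is
also slim" — the `Λ = ℤ` case typed as `PadicFrd.Thm12_iv d` in `PadicFrobenioidThm12.lean`
(abc-iut-L1-t4; FACT-LIST row F-1191).

PROOF-ONLY companion (seat abc-iut-f-047, F fact-proving wave). The earlier assemblies
(`Datum.thm12_iv_of_isFrobenioid'`, `Datum.thm12_iv_of_isMonoidData`, seat abc-iut-L1-d8) run through
[FrdI] Prop. 1.13 (iii) and therefore need "`C` is a Frobenioid" ([FrdI] Thm. 5.2 (ii)), i.e. the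
standing hypothesis `d.IsMonoidData`. Here the statement is proved for EVERY datum `d`, with no
hypothesis, by running the argument of Prop. 1.13 directly on the model category
`C = ModelFrobenioid Φ B Div_B` (objects `(A_D, α)`, arrows `(deg_Fr, Base, Div, u)`):
* (Prop. 1.13 (i) for model categories, `ModelFrobenioid.baseMap_autApp_eq_id`) for ANY model
  Frobenioid over a slim base `D`, every component of an automorphism `η` of `C_A → C` is a
  base-identity automorphism: the lifts `(Y, Φ(h)(α)) —(1, h, 0, 0)→ (A_D, α)` of the arrows
  `h : Y → A_D` of `D_{A_D}` carry `η` to an automorphism of `D_{A_D} → D`, trivial as `D` is slim, and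
  every `f : X → A` maps to the lift of `Base(f)` by `(deg_Fr f, id, Div f, u_f)`;
* (`ModelFrobenioid.unit_eq_pow_of_comm`) naturality along an arrow `(n, id, z, w) : (X_D, ξ) → X`
  exhibits the rational function `u` of a base-identity component as an `n`-th power;
* (`PadicFrd.Datum.autApp_eq_one`) for the `p`-adic Frobenioid the components are units
  `(1, id, 0, u) ∈ O^×(X)` (`Φ(X_D)` monoprime, hence sharp), such arrows `(n, id, z, w) : (X_D, 0) → X`
  exist for every `n ≥ 1` (cofinality of `Div_B`), so `u|_{K^×} ∈ O_{K_X}^×` is infinitely divisible,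
  hence `1` (`PadicUnitsDivisible`: `K_X` is a finite extension of `ℚ_p`, `Datum.isPadicLocal`), hence
  `u = 1` (`B(X_D) = K^× ×_{Φ₀^gp} Φ^gp`).
This is the printed route ("follows formally from [FrdI], Proposition 1.13, (iii) [since … condition (b)
… is always satisfied by objects of `C`]", FrdII p. 9) with the one use of the Frobenioid axioms in
Prop. 1.13 (i) (the equivalence `C^pl-bk_A ⥲ D_{A_D}`, Def. 1.3 (i)(c)) replaced by the explicit lifts
above. No definitions; nothing here bears on [IUTchIII]; no side taken on [IUTchIII] Cor. 3.12.
-/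

namespace Literature.AlgebraicGeometry.Frobenioids

open CategoryTheory Opposite ValuativeRel

universe w v u

namespace ModelFrobenioid

variable {D : Type u} [Category.{v} D] {Φ B : Dᵒᵖ ⥤ CommMonCat.{w}} {DivB : B ⟶ monoidGp Φ}

/-- **[FrdI] Prop. 1.13 (i) for model categories, without Frobenioid hypotheses**: if `D` is slim,
then for every object `A = (A_D, α)` of a model Frobenioid `C` and every automorphism `η` of the
natural functor `C_A → C`, the component of `η` at any `f : X → A` is a base-identity automorphism
of `X` (`Base = id`). The lifts `(Y, Φ(h)(α)) —(1, h, 0, 0)→ A` of the objects `h : Y → A_D` of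
`D_{A_D}` (and `(1, k, 0, 0)` of its arrows) transport `η` to an automorphism of `D_{A_D} → D`, which
is trivial since `D` is slim; and `f` maps to the lift of `Base(f)` by `(deg_Fr f, id, Div f, u_f)`.
[cite: MochizukiFrdI2008, Prop. 1.13(i) p.40] -/
theorem baseMap_autApp_eq_id (hD : IsSlim D) {A : ModelFrobenioid Φ B DivB}
    (η : Over.forget A ≅ Over.forget A) (U : Over A) :
    baseMap (PreFrobenioid.autApp η U).hom = 𝟙 U.left.base := by
  -- the lift `(Y, Φ(h)(α)) —(1, h, 0, 0)→ (A_D, α)` of `h : Y → A_D`, as an object of `C_A`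
  let Lobj : Over A.base → ModelFrobenioid Φ B DivB := fun V => ⟨V.left, pullGp Φ V.hom A.cls⟩
  let Lhom : ∀ V : Over A.base, Lobj V ⟶ A := fun V =>
    { degFr := 1, base := V.hom, div := 1, unit := 1
      rel := by rw [PNat.one_coe, pow_one, map_one, mul_one, map_one, mul_one] }
  let L : Over A.base → Over A := fun V => Over.mk (Lhom V)
  -- the automorphism of `D_{A_D} → D` induced by `η` on the lifts
  let θ : Over.forget A.base ≅ Over.forget A.base :=
    NatIso.ofComponents (fun V => (baseFunctor Φ B DivB).mapIso (PreFrobenioid.autApp η (L V)))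
      (by
        intro V V' κ
        -- the lift `(1, κ, 0, 0) : L V → L V'` of `κ`, a morphism of `C_A`
        let m : L V ⟶ L V' := Over.homMk
          { degFr := 1, base := κ.left, div := 1, unit := 1
            rel := by
              show pullGp Φ V.hom A.cls ^ ((1 : ℕ+) : ℕ) *
                  Algebra.GrothendieckGroup.of (1 : Φ.obj (op V.left)) =
                pullGp Φ κ.left (pullGp Φ V'.hom A.cls) *
                  divB Φ B DivB (op V.left) (1 : B.obj (op V.left))
              rw [PNat.one_coe, pow_one, map_one, mul_one, map_one, mul_one, ← pullGp_comp,
                Over.w κ] }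
          (by
            apply hom_ext
            · show (1 : ℕ+) * 1 = 1
              exact mul_one 1
            · exact Over.w κ
            · show (Φ.map κ.left.op).hom 1 * (1 : Φ.obj (op V.left)) ^ ((1 : ℕ+) : ℕ) = 1
              rw [map_one, one_pow, mul_one]
            · show (B.map κ.left.op).hom 1 * (1 : B.obj (op V.left)) ^ ((1 : ℕ+) : ℕ) = 1
              rw [map_one, one_pow, mul_one])
        have hn := congrArg baseMap (PreFrobenioid.autApp_naturality η m)
        rw [baseMap_comp, baseMap_comp] at hn
        exact hn.symm)
  have hθ : θ = Iso.refl _ := hD.isRigid_forget A.base θ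
  have hL : ∀ V : Over A.base, baseMap (PreFrobenioid.autApp η (L V)).hom = 𝟙 V.left := fun V =>
    congrArg (fun i : Over.forget A.base ≅ Over.forget A.base => i.hom.app V) hθ
  -- `U = (f : X → A)` maps to the lift of `Base(f)` by `(deg_Fr f, id, Div f, u_f)`
  let V₀ : Over A.base := Over.mk (baseMap U.hom)
  let k : U ⟶ L V₀ := Over.homMk
    { degFr := degFr U.hom, base := 𝟙 U.left.base, div := div U.hom, unit := unit U.hom
      rel := by
        show U.left.cls ^ (degFr U.hom : ℕ) * Algebra.GrothendieckGroup.of (div U.hom) =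
          pullGp Φ (𝟙 U.left.base) (pullGp Φ (baseMap U.hom) A.cls) *
            divB Φ B DivB (op U.left.base) (unit U.hom)
        rw [pullGp_id]
        exact rel U.hom }
    (by
      apply hom_ext
      · show (1 : ℕ+) * degFr U.hom = degFr U.hom
        exact one_mul _
      · exact Category.id_comp _
      · show (Φ.map (𝟙 U.left.base).op).hom 1 * div U.hom ^ ((1 : ℕ+) : ℕ) = div U.hom
        rw [map_one, one_mul, PNat.one_coe, pow_one]
      · show (B.map (𝟙 U.left.base).op).hom 1 * unit U.hom ^ ((1 : ℕ+) : ℕ) = unit U.hom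
        rw [map_one, one_mul, PNat.one_coe, pow_one])
  have hk := congrArg baseMap (PreFrobenioid.autApp_naturality η k)
  rw [baseMap_comp, baseMap_comp, hL V₀] at hk
  -- `hk : Base(η_U) ≫ id = id ≫ id`
  exact ((Category.comp_id _).symm.trans hk).trans (Category.id_comp _)

/-- Naturality bookkeeping in a model Frobenioid: if base-identity endomorphisms `a` of `(Y_D, ξ)` and
`b` of `Y = (Y_D, β)` (only `Base(a) = id` and `deg_Fr(b) = 1` are used) are intertwined
(`a ≫ g = g ≫ b`) by an arrow
`g : (Y_D, ξ) → Y` over the identity of `Y_D`, and `B(Y_D)` is group-like, then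
`u_b = deg_Fr(g) · u_a` (read off the composition law `u_{ψ ∘ φ} = B(Base φ)(u_ψ) + deg_Fr(ψ) · u_φ`
of Thm. 5.2 (i)). [cite: MochizukiFrdI2008, Thm. 5.2(i) p.100] -/
theorem unit_eq_pow_of_comm {Y : ModelFrobenioid Φ B DivB} (hB : ∀ u : B.obj (op Y.base), IsUnit u)
    {ξ : Algebra.GrothendieckGroup (Φ.obj (op Y.base))}
    (g : (⟨Y.base, ξ⟩ : ModelFrobenioid Φ B DivB) ⟶ Y) (hg : baseMap g = 𝟙 Y.base)
    (a : (⟨Y.base, ξ⟩ : ModelFrobenioid Φ B DivB) ⟶ ⟨Y.base, ξ⟩) (b : Y ⟶ Y)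
    (ha : baseMap a = 𝟙 Y.base) (hb : degFr b = 1) (h : a ≫ g = g ≫ b) :
    unit b = unit a ^ (degFr g : ℕ) := by
  have hu := congrArg unit h
  rw [unit_comp, unit_comp, ha, hg, hb, map_id_apply_B, map_id_apply_B, PNat.one_coe, pow_one]
    at hu
  -- `hu : u_g * u_a ^ deg g = u_b * u_g`
  have hBg : IsUnit (unit g) := hB _
  exact hBg.mul_right_cancel (hu.symm.trans (mul_comm _ _))

end ModelFrobenioid

namespace PadicFrd

namespace Datum

variable {D : Type u} [Category.{v} D] {p : ℕ} [Fact p.Prime] (d : Datum D p)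

/-- For the `p`-adic Frobenioid `C` of a datum `d` over a slim base `D`, every component of an
automorphism `η` of `C_A → C` is trivial. By `ModelFrobenioid.baseMap_autApp_eq_id` the component at
`f : X → A` is a unit `(1, id, 0, u) ∈ O^×(X)` (`Div = 0` as `Φ(X_D)` is monoprime, hence sharp), so
`Div_B(u) = 0` and `u|_{K^×} ∈ O_{K_X}^×`; naturality along `(n, id, z, w) : (X_D, 0) → X` (cofinality
of `Div_B`) shows `u = n · u_n` for every `n ≥ 1`, hence `u|_{K^×}` is an infinitely divisible unit of
the finite extension `K_X` of `ℚ_p`, i.e. `1`, and `u = 0` since `B(X_D) = K^× ×_{Φ₀^gp} Φ^gp` —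
condition (b) "`⋂_n (O^×)^n = {1}`" of [FrdI] Prop. 1.13 (iii) "is always satisfied by objects of `C`"
(FrdII p. 9). [cite: MochizukiFrdII2008, Thm 1.2 (iv) p.9] -/
theorem autApp_eq_one (hD : IsSlim D) {A : d.frobenioid} (η : Over.forget A ≅ Over.forget A)
    (U : Over A) : PreFrobenioid.autApp η U = 1 := by
  have hsharp : IsSharp (d.Φ.obj (op U.left.base)) := (d.isMonoprime (op U.left.base)).isSharp
  -- every component is a base-identity linear automorphism, i.e. lies in `O^×(−)`
  have hmem : ∀ W : Over A, PreFrobenioid.autApp η W ∈ ModelFrobenioid.units W.left := fun W =>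
    ⟨ModelFrobenioid.baseMap_autApp_eq_id hD η W, (ModelFrobenioid.degFr_hom_eq_one _).1⟩
  -- hence `Div_B(u) = 0` and `u|_{K^×}` is a unit of `O_K`, for the component `(1, id, 0, u)` at `U`
  have hdivB : Frobenioids.divB d.Φ d.B d.divB (op U.left.base)
      (ModelFrobenioid.unit (PreFrobenioid.autApp η U).hom) = 1 := by
    have h := ModelFrobenioid.divB_unitsToRatFn_eq_one hsharp ⟨_, hmem U⟩
    rwa [ModelFrobenioid.coe_unitsToRatFn] at h
  -- `u ↦ u|_{K^×}` at `X_D`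
  let res : d.B.obj (op U.left.base) →* (d.fld U.left.base)ˣ := (d.toB0.app (op U.left.base)).hom
  have hval : valuation (d.fld U.left.base)
      ((res (ModelFrobenioid.unit (PreFrobenioid.autApp η U).hom) : (d.fld U.left.base)ˣ) :
        d.fld U.left.base) = 1 :=
    (mem_unitSubgroup_iff (d.fld U.left.base)).mp (d.toB0_unit_mem_unitSubgroup U.left ⟨_, hmem U⟩)
  -- the arrows `(n, id, z, w) : (X_D, 0) → X = (X_D, ξ)` with `z = ξ + Div_B(w)` (cofinality of `Div_B`)
  obtain ⟨z, w, hzw⟩ := d.divB_cofinal U.left.base U.left.cls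
  let g : ℕ+ → ((⟨U.left.base, 1⟩ : d.frobenioid) ⟶ U.left) := fun n =>
    { degFr := n, base := 𝟙 U.left.base, div := z, unit := w
      rel := by
        show (1 : Algebra.GrothendieckGroup (d.Φ.obj (op U.left.base))) ^ (n : ℕ) *
            Algebra.GrothendieckGroup.of z =
          pullGp d.Φ (𝟙 U.left.base) U.left.cls * Frobenioids.divB d.Φ d.B d.divB (op U.left.base) w
        rw [one_pow, one_mul, pullGp_id, hzw] }
  let Un : ℕ+ → Over A := fun n => Over.mk (g n ≫ U.hom)
  -- naturality along `g n`: `u_U = n · u_{U_n}`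
  have hpow : ∀ n : ℕ+, ModelFrobenioid.unit (PreFrobenioid.autApp η U).hom =
      ModelFrobenioid.unit (PreFrobenioid.autApp η (Un n)).hom ^ (n : ℕ) := fun n =>
    ModelFrobenioid.unit_eq_pow_of_comm (fun u => d.isUnit_B _ u) (g n) rfl
      (PreFrobenioid.autApp η (Un n)).hom (PreFrobenioid.autApp η U).hom (hmem (Un n)).1 (hmem U).2
      (PreFrobenioid.autApp_naturality η (Over.homMk (g n) rfl : Un n ⟶ U))
  -- `u_U|_{K^×}` is an infinitely divisible unit of `O_K`, `K` finite over `ℚ_p`: it is `1`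
  obtain ⟨⟨inst, hfin, hc⟩⟩ := d.isPadicLocal U.left.base
  letI := inst
  haveI := hfin
  have hx : ((res (ModelFrobenioid.unit (PreFrobenioid.autApp η U).hom) : (d.fld U.left.base)ˣ) :
      d.fld U.left.base) = 1 := by
    refine eq_one_of_valuation_eq_one_of_forall_exists_pow_eq hc hval fun n hn => ?_
    -- an `n`-th root: the restriction of `u_{U_n}`
    let un : d.B.obj (op U.left.base) :=
      (ModelFrobenioid.unit (PreFrobenioid.autApp η (Un (Nat.toPNat n hn))).hom :)
    have h1 : ModelFrobenioid.unit (PreFrobenioid.autApp η U).hom = un ^ n := hpow (Nat.toPNat n hn)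
    refine ⟨((res un : (d.fld U.left.base)ˣ) : d.fld U.left.base), ?_⟩
    rw [← Units.val_pow_eq_pow_val, ← map_pow, ← h1]
  -- hence `u_U = 0` in `B(X_D) = K^× ×_{Φ₀^gp} Φ^gp`
  have hunit : ModelFrobenioid.unit (PreFrobenioid.autApp η U).hom = 1 := by
    refine d.B_ext (op U.left.base) ?_ ?_
    · show res (ModelFrobenioid.unit (PreFrobenioid.autApp η U).hom) = res 1
      rw [map_one]
      exact Units.val_eq_one.mp hx
    · rw [map_one]
      exact hdivB
  -- and the component `(1, id, 0, 0)` is the identity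
  apply Aut.ext
  apply ModelFrobenioid.hom_ext
  · exact (ModelFrobenioid.degFr_hom_eq_one _).1
  · exact (hmem U).1
  · exact ModelFrobenioid.div_eq_one_of_mem_units hsharp (hmem U)
  · exact hunit

/-- **Theorem 1.2 (iv)** (FrdII p. 9), `Λ = ℤ`, UNCONDITIONAL: "If `D` is slim, then `C` is also slim"
for the `p`-adic Frobenioid `C = d.frobenioid` of ANY datum `d : PadicFrd.Datum D p` — the named fact
`PadicFrd.Thm12_iv d` of `PadicFrobenioidThm12.lean` (FACT-LIST row F-1191, [FrdII] Theorem 1.2 (iv)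
p. 9), discharging the hypothesis `d.IsMonoidData` of `Datum.thm12_iv_of_isMonoidData`.
[cite: MochizukiFrdII2008, Thm 1.2 (iv) p.9] -/
theorem thm12_iv_holds : Literature.AlgebraicGeometry.Frobenioids.PadicFrd.Thm12_iv d := fun hD =>
  ⟨fun _ η => Iso.ext (NatTrans.ext (funext fun U => congrArg Iso.hom (d.autApp_eq_one hD η U)))⟩

/-- `Thm12_iv` — `_holds` alias of `thm12_iv_holds` above under the fact's exact name (appended
2026-08-28, D-0026 bookkeeping: the proof term is the existing theorem of this file; no statement,
definition or attribute is edited; no new named fact; the ledger's debt table listed the fact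
unproved). [cite: MochizukiFrdII2008, Thm 1.2 (iv) p.9] -/
theorem _root_.Literature.AlgebraicGeometry.Frobenioids.PadicFrd.Thm12_iv_holds :
    Literature.AlgebraicGeometry.Frobenioids.PadicFrd.Thm12_iv d :=
  _root_.Literature.AlgebraicGeometry.Frobenioids.PadicFrd.Datum.thm12_iv_holds (d := d)

end Datum

end PadicFrd

end Literature.AlgebraicGeometry.Frobenioids
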